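import Literature.Probability.LatticeModels.KilledWalkHarnack
import Literature.Probability.LatticeModels.WeakBeurlingEstimate
import HarnessLib

/-!
# Harnack comparability along a fat path of clean boxes
(line `symplectic-fermion-anchor`, crux `SAWLoopFugacityFlow.AvoidanceLimit`, stmt-CriticalPhenomena-10649)

The "fat part of a wall" step of Chelkak's hub factorisation of the exit kernels of the
edge-killed walk `Gr ≤ ℤ²` (Chelkak 2016, proof of Proposition 3.3: "this portion can be covered
by a uniformly bounded number of discs"). Let `π` be a `Gr`-walk from `a` to `z` inside the box
`sqBox a N`, every site `v` of which carries a *clean frame*: `mW v k ⊆ Λ` and all four lattice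
edges at every site of `mW v k` are `Gr`-edges. For `h ≥ 0` killed-harmonic on `Λ`, the one-box
Harnack inequality `harnack_box_killed` (`(c_*/2) h v ≤ h w` for `w ∈ mB v k`) then chains along
`π` with a number of factors bounded by **packing**, independently of the length of `π`:
`(c_*/2) ^ (2 (N/(6k) + 2)² + 2) · h a ≤ h z` (`harnack_fatPath`).

Proof. Tile the plane by square cells of side `12k + 1` (cell of `v` =
`(⌊(v₀ - a₀ + N)/(12k+1)⌋, ⌊(v₁ - a₁ + N)/(12k+1)⌋)`); two sites of one cell are within
sup-distance `12k`, so one Harnack factor compares them, and one factor compares the endpoints of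
an edge. From index `i`, jump to the LAST index `j` of `π` in the cell of `π i` (one factor), then
step to `j + 1` (one factor); the cell of `π i` is never visited after `j`, so the set of cells
visited from `j + 1` on is strictly smaller (`fatPath_chain_bound`, induction). The sites of `π`
lie in `sqBox a N`, whose cells form a `(N/(6k) + 1) × (N/(6k) + 1)` array
(`fatPath_toNat_div_le`), whence at most `2 (N/(6k) + 1)²` factors; a larger exponent only weakens
the bound since `0 < c_*/2 ≤ 1`.

[cite: Chelkak2016, Proposition 3.3]
-/

noncomputable section

open scoped BigOperators Classical
open Finset Literature.Probability.LatticeModels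

namespace Summit.CriticalPhenomena.SAWScalingLimit.Theorems.AvoidanceLimit.Anchor

/-- **Last index with a property.** If `P i` holds and `i ≤ L`, there is a last index `j ∈ [i, L]`
with `P j`: no `j' ∈ (j, L]` satisfies `P`. (`Nat.findGreatest`.) [folklore] -/
theorem fatPath_exists_last_index {P : ℕ → Prop} {i L : ℕ} (hi : i ≤ L) (hP : P i) :
    ∃ j, i ≤ j ∧ j ≤ L ∧ P j ∧ ∀ j', j < j' → j' ≤ L → ¬P j' :=
  ⟨Nat.findGreatest P L, Nat.le_findGreatest hi hP, Nat.findGreatest_le L,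
    Nat.findGreatest_spec hi hP, fun _ h1 h2 => Nat.findGreatest_is_greatest h1 h2⟩

/-- **Chain bound by the number of visited cells.** Let `f : ℕ → ℝ` be nonnegative, `0 ≤ θ ≤ 1`,
and `c : ℕ → α` a labelling ("cell") of the indices `0, …, L` such that `θ f i ≤ f j` whenever
`i ≤ j ≤ L` have the same label, and `θ f i ≤ f (i+1)` for `i < L`. Then
`θ ^ (2 · #{labels of [i, L]}) f i ≤ f L` for every `i ≤ L`: jump from `i` to the last index `j`
with the label of `i`, then to `j + 1`; the label of `i` is not used on `[j+1, L]`.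
[cite: Chelkak2016, Proposition 3.3] -/
theorem fatPath_chain_bound {α : Type*} [DecidableEq α] (c : ℕ → α) (f : ℕ → ℝ) (θ : ℝ) (L : ℕ)
    (hθ0 : 0 ≤ θ) (hθ1 : θ ≤ 1) (hf : ∀ i, 0 ≤ f i)
    (hsame : ∀ i j, i ≤ j → j ≤ L → c i = c j → θ * f i ≤ f j)
    (hstep : ∀ i, i < L → θ * f i ≤ f (i + 1)) :
    ∀ i, i ≤ L → θ ^ (2 * ((Finset.Icc i L).image c).card) * f i ≤ f L := by
  -- strong induction on `L - i`, phrased as induction on a bound `n ≥ L - i`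
  suffices key : ∀ n i, i ≤ L → L - i ≤ n → θ ^ (2 * ((Finset.Icc i L).image c).card) * f i ≤ f L from
    fun i hi => key (L - i) i hi le_rfl
  have hmem : ∀ i j, i ≤ j → j ≤ L → c j ∈ (Finset.Icc i L).image c := fun i j hij hjL =>
    Finset.mem_image.2 ⟨j, Finset.mem_Icc.2 ⟨hij, hjL⟩, rfl⟩
  intro n
  induction n with
  | zero =>
    intro i hi hn
    have hiL : i = L := by omega
    rw [hiL]
    exact mul_le_of_le_one_left (hf _) (pow_le_one₀ hθ0 hθ1)
  | succ n ih =>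
    intro i hi hn
    -- the last index `j ∈ [i, L]` with the label of `i`
    obtain ⟨j, hij, hjL, hcj, hmax⟩ := fatPath_exists_last_index (P := fun j => c j = c i) hi rfl
    have h1 : θ * f i ≤ f j := hsame i j hij hjL hcj.symm
    have hpos : 0 < ((Finset.Icc i L).image c).card := Finset.card_pos.2 ⟨_, hmem i i le_rfl hi⟩
    rcases hjL.eq_or_lt with hjeq | hjlt
    · -- `j = L`: one factor suffices
      calc θ ^ (2 * ((Finset.Icc i L).image c).card) * f i ≤ θ ^ 1 * f i :=
            mul_le_mul_of_nonneg_right (pow_le_pow_of_le_one hθ0 hθ1 (by omega)) (hf _)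
        _ ≤ f j := by rw [pow_one]; exact h1
        _ = f L := by rw [hjeq]
    · -- `j < L`: two factors, and the label of `i` disappears from `[j+1, L]`
      have h2 : θ * f j ≤ f (j + 1) := hstep j hjlt
      have hsub : (Finset.Icc (j + 1) L).image c ⊆ ((Finset.Icc i L).image c).erase (c i) := by
        intro x hx
        obtain ⟨j', hj', rfl⟩ := Finset.mem_image.1 hx
        rw [Finset.mem_Icc] at hj'
        exact Finset.mem_erase.2 ⟨hmax j' (by omega) hj'.2, hmem i j' (by omega) hj'.2⟩
      have hcard : ((Finset.Icc (j + 1) L).image c).card + 1 ≤ ((Finset.Icc i L).image c).card := by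
        have h := Finset.card_le_card hsub
        rw [Finset.card_erase_of_mem (hmem i i le_rfl hi)] at h
        omega
      have ih' := ih (j + 1) hjlt (by omega)
      have hpow : θ ^ (2 * ((Finset.Icc i L).image c).card) ≤
          θ ^ (2 * ((Finset.Icc (j + 1) L).image c).card + 2) :=
        pow_le_pow_of_le_one hθ0 hθ1 (by omega)
      calc θ ^ (2 * ((Finset.Icc i L).image c).card) * f i
          ≤ θ ^ (2 * ((Finset.Icc (j + 1) L).image c).card + 2) * f i :=
            mul_le_mul_of_nonneg_right hpow (hf _)
        _ = θ ^ (2 * ((Finset.Icc (j + 1) L).image c).card) * (θ * (θ * f i)) := by ring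
        _ ≤ θ ^ (2 * ((Finset.Icc (j + 1) L).image c).card) * (θ * f j) := by gcongr
        _ ≤ θ ^ (2 * ((Finset.Icc (j + 1) L).image c).card) * f (j + 1) := by gcongr
        _ ≤ f L := ih'

/-- **Counting cells.** A finite family of pairs of naturals with both coordinates `≤ q` has at most
`(q + 1)²` distinct values. [folklore] -/
theorem fatPath_card_image_le_sq {ι : Type*} (s : Finset ι) (c : ι → ℕ × ℕ) (q : ℕ)
    (hc : ∀ i ∈ s, (c i).1 ≤ q ∧ (c i).2 ≤ q) : (s.image c).card ≤ (q + 1) ^ 2 := by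
  have hsub : s.image c ⊆ Finset.range (q + 1) ×ˢ Finset.range (q + 1) := by
    intro x hx
    obtain ⟨i, hi, rfl⟩ := Finset.mem_image.1 hx
    rw [Finset.mem_product, Finset.mem_range, Finset.mem_range, Nat.lt_succ_iff, Nat.lt_succ_iff]
    exact hc i hi
  calc (s.image c).card ≤ (Finset.range (q + 1) ×ˢ Finset.range (q + 1)).card := Finset.card_le_card hsub
    _ = (q + 1) ^ 2 := by rw [Finset.card_product, Finset.card_range, sq]

/-- **Two sites of one cell are close.** If two naturals have the same quotient by `s > 0`, they
differ by less than `s` (as integers). [folklore] -/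
theorem fatPath_sub_lt_of_div_eq {X Y s : ℕ} (hs : 0 < s) (h : X / s = Y / s) :
    (X : ℤ) - Y < s ∧ (Y : ℤ) - X < s := by
  have ex := Nat.div_add_mod X s
  have ey := Nat.div_add_mod Y s
  have mx := Nat.mod_lt X hs
  have my := Nat.mod_lt Y hs
  rw [h] at ex
  generalize s * (Y / s) = t at ex ey
  generalize X % s = rx at ex mx
  generalize Y % s = ry at ey my
  omega

/-- **Cells of the box form a small array.** For an integer `x ≤ 2N` and `k > 0`:
`⌊x⁺/(12k+1)⌋ ≤ N/(6k)` (natural-number divisions), since `2N/(12k+1) ≤ 2N/(12k) = N/(6k)`.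
[folklore] -/
theorem fatPath_toNat_div_le {x : ℤ} {N k : ℕ} (hk : 0 < k) (hx : x ≤ 2 * N) :
    x.toNat / (12 * k + 1) ≤ N / (6 * k) := by
  have h1 : x.toNat ≤ 2 * N := by
    rw [Int.toNat_le]; exact_mod_cast hx
  calc x.toNat / (12 * k + 1) ≤ 2 * N / (12 * k + 1) := Nat.div_le_div_right h1
    _ ≤ 2 * N / (2 * (6 * k)) := Nat.div_le_div_left (by omega) (by omega)
    _ = N / (6 * k) := Nat.mul_div_mul_left N (6 * k) two_pos

/-- **Harnack comparability along a fat path (Chelkak's "bounded number of discs").** Let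
`Gr ≤ ℤ²`, `Λ` finite, `k > 0`, and `π` a `Gr`-walk from `a` to `z` all of whose sites lie in
`sqBox a N` and carry clean frames (`mW v k ⊆ Λ`, every lattice edge at every site of `mW v k` is a
`Gr`-edge). Then for every `h ≥ 0` killed-harmonic on `Λ`,
`(c_*/2) ^ (2 (N/(6k) + 2)² + 2) · h a ≤ h z`. The exponent counts Harnack boxes by packing (cells
of side `12k + 1` of the box `sqBox a N`, two factors per visited cell), not by the length of `π`.
[cite: Chelkak2016, Proposition 3.3] -/
theorem harnack_fatPath :
    ∀ (Gr : SimpleGraph (Site 2)), Gr ≤ zdGraph 2 → ∀ (Λ : Set (Site 2)), Λ.Finite →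
      ∀ (k : ℕ), 0 < k → ∀ (N : ℕ) {a z : Site 2} (π : Gr.Walk a z),
      (∀ v ∈ π.support, v ∈ WeakBeurling.sqBox a N) → (∀ v ∈ π.support, mW v k ⊆ Λ) →
      (∀ v ∈ π.support, ∀ w ∈ mW v k, ∀ e : SRW.Dir 2, Gr.Adj w (w + SRW.stepVec e)) →
      ∀ (h : Site 2 → ℝ), (∀ w, 0 ≤ h w) → IsKilledHarmonicOn Gr h Λ →
      (maneuverConst / 2) ^ (2 * (N / (6 * k) + 2) ^ 2 + 2) * h a ≤ h z := by
  intro Gr hGr Λ _hΛ k hk N a z π hbox hΛ hclean h hpos hharm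
  have hθ0 : (0 : ℝ) ≤ maneuverConst / 2 := by have := maneuverConst_pos; positivity
  have hθ1 : maneuverConst / 2 ≤ 1 := by have := maneuverConst_le_one; linarith
  -- the cell of a site: side `12k + 1`, origin at the corner `a - (N, N)` of `sqBox a N`
  let cell : Site 2 → ℕ × ℕ := fun v =>
    ((v 0 - a 0 + N).toNat / (12 * k + 1), (v 1 - a 1 + N).toNat / (12 * k + 1))
  -- one Harnack factor between a path site and a site of the box in the same cell
  have one_box : ∀ v w : Site 2, v ∈ π.support → w ∈ WeakBeurling.sqBox a N → cell v = cell w →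
      maneuverConst / 2 * h v ≤ h w := by
    intro v w hv hw hvw
    have hv' := hbox v hv
    rw [WeakBeurling.mem_sqBox, abs_le, abs_le] at hv' hw
    have e0 : (((v 0 - a 0 + N).toNat : ℕ) : ℤ) = v 0 - a 0 + N := Int.toNat_of_nonneg (by omega)
    have e1 : (((v 1 - a 1 + N).toNat : ℕ) : ℤ) = v 1 - a 1 + N := Int.toNat_of_nonneg (by omega)
    have f0 : (((w 0 - a 0 + N).toNat : ℕ) : ℤ) = w 0 - a 0 + N := Int.toNat_of_nonneg (by omega)
    have f1 : (((w 1 - a 1 + N).toNat : ℕ) : ℤ) = w 1 - a 1 + N := Int.toNat_of_nonneg (by omega)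
    have hc0 : (v 0 - a 0 + N).toNat / (12 * k + 1) = (w 0 - a 0 + N).toNat / (12 * k + 1) :=
      congrArg Prod.fst hvw
    have hc1 : (v 1 - a 1 + N).toNat / (12 * k + 1) = (w 1 - a 1 + N).toNat / (12 * k + 1) :=
      congrArg Prod.snd hvw
    have d0 := fatPath_sub_lt_of_div_eq (by omega) hc0
    have d1 := fatPath_sub_lt_of_div_eq (by omega) hc1
    have hwB : w ∈ mB v k := by
      constructor <;> rw [abs_le] <;> push_cast at d0 d1 ⊢ <;> constructor <;> omega
    exact harnack_box_killed v hk (hclean v hv) (hharm.mono (hΛ v hv)) hpos hwB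
  -- one Harnack factor along an edge of the path
  have one_step : ∀ i, i < π.length →
      maneuverConst / 2 * h (π.getVert i) ≤ h (π.getVert (i + 1)) := by
    intro i hi
    have hadj : Gr.Adj (π.getVert i) (π.getVert (i + 1)) := π.adj_getVert_succ hi
    have hv := π.getVert_mem_support i
    have hst := WeakBeurling.coord_step_of_adj (hGr hadj)
    have hk1 : (1 : ℤ) ≤ 12 * (k : ℤ) := by omega
    have hwB : π.getVert (i + 1) ∈ mB (π.getVert i) k := by
      constructor <;> rw [abs_le] <;>
        rcases hst with ⟨h0, h1⟩ | ⟨h0, h1⟩ | ⟨h0, h1⟩ | ⟨h0, h1⟩ <;> constructor <;> omega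
    exact harnack_box_killed _ hk (hclean _ hv) (hharm.mono (hΛ _ hv)) hpos hwB
  -- the chain bound with the cell labelling of the indices of `π`
  have hchain := fatPath_chain_bound (fun i => cell (π.getVert i)) (fun i => h (π.getVert i))
    (maneuverConst / 2) π.length hθ0 hθ1 (fun i => hpos _)
    (fun i j _ _ hij => one_box _ _ (π.getVert_mem_support i) (hbox _ (π.getVert_mem_support j)) hij)
    one_step 0 (Nat.zero_le _)
  rw [π.getVert_zero, π.getVert_length] at hchain
  -- counting the cells of `sqBox a N`
  have hcount :
      ((Finset.Icc 0 π.length).image (fun i => cell (π.getVert i))).card ≤ (N / (6 * k) + 1) ^ 2 := by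
    refine fatPath_card_image_le_sq _ _ _ fun i _ => ?_
    have hv := hbox _ (π.getVert_mem_support i)
    rw [WeakBeurling.mem_sqBox, abs_le, abs_le] at hv
    exact ⟨fatPath_toNat_div_le hk (by omega), fatPath_toNat_div_le hk (by omega)⟩
  have hsq : (N / (6 * k) + 1) ^ 2 ≤ (N / (6 * k) + 2) ^ 2 := Nat.pow_le_pow_left (by omega) 2
  calc (maneuverConst / 2) ^ (2 * (N / (6 * k) + 2) ^ 2 + 2) * h a
      ≤ (maneuverConst / 2) ^ (2 * ((Finset.Icc 0 π.length).image (fun i => cell (π.getVert i))).card)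
          * h a :=
        mul_le_mul_of_nonneg_right (pow_le_pow_of_le_one hθ0 hθ1 (by omega)) (hpos _)
    _ ≤ h z := hchain

end Summit.CriticalPhenomena.SAWScalingLimit.Theorems.AvoidanceLimit.Anchor

end
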